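import Literature.Geometry.Lorentzian.ErnstBalanceCandidates

/-!
# Kerr sanity checks for `Ernst.balanceCandidates` (`n = 1`)

Companion of `Literature/Geometry/Lorentzian/ErnstBalanceCandidates.lean` (definition request
`defn-Ernst.balanceCandidates`): for the Kerr LP data `Ernst.kerr p q` (`M = p² + q²`, `a = 2pq`,
`σ = p² − q²`, `r₊ = 2p²`) we verify in Lean that

* Hennig's parameter conditions hold: `tr r⁺ ≡ 0`, in fact
  `r⁺(ζ) = [[2iMa, (ζ + M)² + a²], [(ζ − M)² + a², −2iMa]]` (`kerr_paramConditions`,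
  `kerr_upperNum`, `kerr_upperDen`);
* the reduced data `π₁ = ζ − M − ia`, `r₁ = ζ + M − ia` are consistent and the LP chain returns the
  Kerr axis potential `𝓔⁺ = (ζ − M − ia)/(ζ + M − ia)` [Hennig2019 §1; Hennig2026 §4, case n = 1]
  (`kerr_axisDataConsistent`, `kerr_upperAxisPotential`);
* `½ ∂_ζ 𝓔⁺(K₁) = κ + iΩ` with the Kerr surface gravity `κ = σ/(2Mr₊)` and angular velocity
  `Ω = a/(2Mr₊)` [NeugebauerHennig2009 eq. (54)] (`kerr_halfDeriv`);
* hence `J = Ma`, `A = 8πMr₊`, and a sub-extremal Kerr black hole (`0 < q² < p²`) lies in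
  `balanceCandidates 1 (fun _ => True)` (`kerr_mem_balanceCandidates`): the candidate set is
  non-vacuous for `n = 1` and the thermodynamic block (`komarMass`, `angularMomentum`,
  `surfaceGravity`, `horizonArea`) returns the Kerr values.

## References

* G. Neugebauer, J. Hennig, Gen. Relativ. Gravit. 41 (2009) 2113, eqs. (51)–(54). [NeugebauerHennig2009]
* G. Neugebauer, J. Hennig, J. Geom. Phys. 62 (2012) 613, §4. [NeugebauerHennig2012]
* J. Hennig, Class. Quantum Grav. 36 (2019) 235001, §1. [Hennig2019]
* J. Hennig, J. Phys. Conf. Ser. 3177 (2026) 012022, §4. [Hennig2026]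
-/

noncomputable section

open Complex ComplexConjugate Matrix

namespace Literature.Geometry.Lorentzian.Ernst
/-- `I³ = −I`. [folklore] -/
private theorem I_pow_three : I ^ 3 = -I := by
  rw [pow_succ, Complex.I_sq]; ring

/-- The Kerr data satisfy Hennig's parameter conditions (`tr r⁺ ≡ 0`); indeed
`r⁺(ζ) = [[2iMa, (ζ + M)² + a²], [(ζ − M)² + a², −2iMa]]`.
[cite: NeugebauerHennig2012, §4.1 (tr 𝐑⁺ = 0); Hennig2020 §3] -/
theorem kerr_paramConditions (p q : ℝ) (hp : p ≠ 0) (hq : q ≠ 0) :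
    (kerr p q).ParamConditions := by
  intro ζ
  have hp' : (p : ℂ) ≠ 0 := by exact_mod_cast hp
  have hq' : (q : ℂ) ≠ 0 := by exact_mod_cast hq
  simp [BalanceParams.rPlus, BalanceParams.rPlusFactor, BalanceParams.coupling,
    BalanceParams.omegaPole, BalanceParams.horizonOf, BalanceParams.Fmat, BalanceParams.swap, kerr,
    List.ofFn_succ, Matrix.trace, Fin.sum_univ_two, Matrix.mul_apply, Matrix.add_apply,
    Matrix.smul_apply]
  field_simp
  ring_nf
  simp only [Complex.I_sq]
  ring

/-- Kerr: the numerator `π₂ − r⁺₁₁` of `𝓔⁺` factors as `(ζ − M − ia)(ζ + M + ia)`.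
[cite: NeugebauerHennig2012, §4.2 (f⁺); Hennig2019 §1 (Kerr axis data)] -/
theorem kerr_upperNum (p q : ℝ) (hp : p ≠ 0) (hq : q ≠ 0) (ζ : ℂ) :
    (kerr p q).upperNum ζ =
      (ζ - ((p : ℂ) ^ 2 + q ^ 2) - I * (2 * p * q)) * (ζ + ((p : ℂ) ^ 2 + q ^ 2) + I * (2 * p * q)) := by
  have hp' : (p : ℂ) ≠ 0 := by exact_mod_cast hp
  have hq' : (q : ℂ) ≠ 0 := by exact_mod_cast hq
  simp [BalanceParams.upperNum, BalanceParams.polePoly, BalanceParams.rPlus,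
    BalanceParams.rPlusFactor, BalanceParams.coupling, BalanceParams.omegaPole,
    BalanceParams.horizonOf, BalanceParams.Fmat, BalanceParams.swap, kerr, List.ofFn_succ,
    Fin.prod_univ_two, Matrix.mul_apply, Matrix.add_apply, Matrix.smul_apply]
  field_simp
  ring_nf
  simp only [Complex.I_sq, I_pow_three]
  ring

/-- Kerr: the denominator `r⁺₁₂` of `𝓔⁺` factors as `(ζ + M − ia)(ζ + M + ia)`.
[cite: NeugebauerHennig2012, §4.2 (f⁺); Hennig2019 §1 (Kerr axis data)] -/
theorem kerr_upperDen (p q : ℝ) (hp : p ≠ 0) (hq : q ≠ 0) (ζ : ℂ) :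
    (kerr p q).upperDen ζ =
      (ζ + ((p : ℂ) ^ 2 + q ^ 2) - I * (2 * p * q)) * (ζ + ((p : ℂ) ^ 2 + q ^ 2) + I * (2 * p * q)) := by
  have hp' : (p : ℂ) ≠ 0 := by exact_mod_cast hp
  have hq' : (q : ℂ) ≠ 0 := by exact_mod_cast hq
  simp [BalanceParams.upperDen, BalanceParams.rPlus,
    BalanceParams.rPlusFactor, BalanceParams.coupling, BalanceParams.omegaPole,
    BalanceParams.horizonOf, BalanceParams.Fmat, BalanceParams.swap, kerr, List.ofFn_succ,
    Matrix.mul_apply, Matrix.add_apply, Matrix.smul_apply]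
  field_simp
  ring_nf
  simp only [Complex.I_sq]
  ring

/-- Kerr: the reduced data `π₁ = ζ − M − ia`, `r₁ = ζ + M − ia` are consistent with the LP data
(`(π₂ − r⁺₁₁)·r₁ = π₁·r⁺₁₂`). [cite: Hennig2020, §3 (𝓔 = πₙ/rₙ); Hennig2019 §1 (Kerr axis data)] -/
theorem kerr_axisDataConsistent (p q : ℝ) (hp : p ≠ 0) (hq : q ≠ 0) :
    (kerr p q).AxisDataConsistent := by
  intro ζ
  rw [kerr_upperNum p q hp hq, kerr_upperDen p q hp hq]
  simp [BalanceParams.rEval, BalanceParams.piEval, kerr]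
  ring

/-- **Kerr axis potential** (`n = 1` sanity check): the upper-axis Ernst potential computed from the
LP chain is `𝓔⁺(ζ) = (ζ − M − ia)/(ζ + M − ia)` with `M = p² + q²`, `a = 2pq` (away from the
conjugate zero `ζ = −M − ia` of the unreduced denominator).
[cite: Hennig2019, §1 (Kerr axis data); NeugebauerHennig2012 §4.2 (f⁺); Hennig2026 §4 (case n = 1)] -/
theorem kerr_upperAxisPotential (p q : ℝ) (hp : p ≠ 0) (hq : q ≠ 0) (ζ : ℂ)
    (hζ : ζ + ((p : ℂ) ^ 2 + q ^ 2) + I * (2 * p * q) ≠ 0) :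
    (kerr p q).upperAxisPotential ζ =
      (ζ - ((p : ℂ) ^ 2 + q ^ 2) - I * (2 * p * q)) / (ζ + ((p : ℂ) ^ 2 + q ^ 2) - I * (2 * p * q)) := by
  have hnum := kerr_upperNum p q hp hq ζ
  have hden := kerr_upperDen p q hp hq ζ
  simp only [BalanceParams.upperNum, BalanceParams.upperDen] at hnum hden
  simp only [BalanceParams.upperAxisPotential, BalanceParams.axisPotential,
    BalanceParams.segmentMatrix, BalanceParams.chain, BalanceParams.upperDen,
    Matrix.of_apply, Matrix.cons_val', Matrix.cons_val_zero, Matrix.cons_val_one,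
    Matrix.empty_val', Matrix.cons_val_fin_one]
  rw [add_zero, ← sub_eq_add_neg, hnum, hden, mul_div_mul_right _ _ hζ]

/-- Kerr: the upper-axis potential as an (unreduced) rational function of a real variable,
`𝓔⁺(t) = (t² − (M + ia)²) / (t² + 2Mt + M² + a²)`. [cite: NeugebauerHennig2012, §4.2 (f⁺)] -/
theorem kerr_axisPotential_zero (p q : ℝ) (hp : p ≠ 0) (hq : q ≠ 0) (t : ℝ) :
    (kerr p q).axisPotential 0 (t : ℂ) =
      ((t : ℂ) * t - (((p : ℂ) ^ 2 + q ^ 2) + I * (2 * p * q)) ^ 2) /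
        ((t : ℂ) * t + 2 * ((p : ℂ) ^ 2 + q ^ 2) * t
          + (((p : ℂ) ^ 2 + q ^ 2) ^ 2 + (2 * (p : ℂ) * q) ^ 2)) := by
  have hnum := kerr_upperNum p q hp hq t
  have hden := kerr_upperDen p q hp hq t
  simp only [BalanceParams.upperNum, BalanceParams.upperDen] at hnum hden
  simp only [BalanceParams.axisPotential, BalanceParams.segmentMatrix, BalanceParams.chain,
    BalanceParams.upperDen, Matrix.of_apply, Matrix.cons_val', Matrix.cons_val_zero,
    Matrix.cons_val_one, Matrix.empty_val', Matrix.cons_val_fin_one]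
  rw [add_zero, ← sub_eq_add_neg, hnum, hden]
  have hI : I ^ 2 = -1 := Complex.I_sq
  congr 1 <;> first | ring1 | linear_combination (-(4 : ℂ) * p ^ 2 * q ^ 2) * hI

/-- Kerr: `½ ∂_ζ𝓔⁺(K₁) = κ + iΩ` with `κ = σ/(2Mr₊)`, `Ω = a/(2Mr₊)` (`σ = p² − q²`, `M = p² + q²`,
`a = 2pq`, `r₊ = 2p²`). [cite: NeugebauerHennig2009, eq. (54)] -/
theorem kerr_halfDeriv (p q : ℝ) (hp : p ≠ 0) (hq : q ≠ 0) :
    (kerr p q).halfDeriv 0 =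
      ((p ^ 2 - q ^ 2) / (2 * (p ^ 2 + q ^ 2) * (2 * p ^ 2)) : ℝ)
        + I * ((2 * p * q) / (2 * (p ^ 2 + q ^ 2) * (2 * p ^ 2)) : ℝ) := by
  have hp' : (p : ℂ) ≠ 0 := by exact_mod_cast hp
  have hq' : (q : ℂ) ≠ 0 := by exact_mod_cast hq
  have hM0 : (p : ℂ) ^ 2 + q ^ 2 ≠ 0 := by
    intro h
    have : (p ^ 2 + q ^ 2 : ℝ) = 0 := by exact_mod_cast h
    nlinarith [sq_nonneg p, sq_nonneg q, sq_pos_of_ne_zero hp]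
  -- abbreviations
  set M : ℂ := (p : ℂ) ^ 2 + q ^ 2 with hM
  set A : ℂ := M + I * (2 * p * q) with hA
  set c : ℂ := M ^ 2 + (2 * (p : ℂ) * q) ^ 2 with hc
  set σ : ℝ := p ^ 2 - q ^ 2 with hσ
  have hfun : (fun t : ℝ => (kerr p q).axisPotential (Fin.castSucc 0) (t : ℂ)) =
      fun t : ℝ => ((t : ℂ) * t - A ^ 2) / ((t : ℂ) * t + 2 * M * t + c) := by
    funext t
    simp only [Fin.castSucc_zero]
    rw [kerr_axisPotential_zero p q hp hq t]
  -- value of the denominator at σ : D(σ) = 2 M r₊ with r₊ = 2p²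
  have hDσ : (σ : ℂ) * σ + 2 * M * σ + c = 2 * M * (2 * (p : ℂ) ^ 2) := by
    simp only [hσ, hc, hM]; push_cast; ring
  have hD0 : (σ : ℂ) * σ + 2 * M * σ + c ≠ 0 := by
    rw [hDσ, hM]
    exact mul_ne_zero (mul_ne_zero two_ne_zero hM0) (mul_ne_zero two_ne_zero (pow_ne_zero 2 hp'))
  have hN : HasDerivAt (fun ζ : ℂ => ζ * ζ - A ^ 2) (1 * (σ : ℂ) + (σ : ℂ) * 1) (σ : ℂ) :=
    ((hasDerivAt_id (σ : ℂ)).mul (hasDerivAt_id (σ : ℂ))).sub_const (A ^ 2)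
  have hD : HasDerivAt (fun ζ : ℂ => ζ * ζ + 2 * M * ζ + c)
      (1 * (σ : ℂ) + (σ : ℂ) * 1 + 2 * M * 1) (σ : ℂ) :=
    (((hasDerivAt_id (σ : ℂ)).mul (hasDerivAt_id (σ : ℂ))).add
      ((hasDerivAt_id (σ : ℂ)).const_mul (2 * M))).add_const c
  have hE : HasDerivAt (fun t : ℝ => ((t : ℂ) * t - A ^ 2) / ((t : ℂ) * t + 2 * M * t + c))
      (((1 * (σ : ℂ) + (σ : ℂ) * 1) * ((σ : ℂ) * σ + 2 * M * σ + c)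
        - ((σ : ℂ) * σ - A ^ 2) * (1 * (σ : ℂ) + (σ : ℂ) * 1 + 2 * M * 1))
        / ((σ : ℂ) * σ + 2 * M * σ + c) ^ 2) σ :=
    (hN.div hD hD0).comp_ofReal
  have hK : (kerr p q).K (BalanceParams.top 0) = σ := by
    simp [kerr, BalanceParams.top, hσ]
  have hval : (kerr p q).halfDeriv 0 =
      ((1 * (σ : ℂ) + (σ : ℂ) * 1) * ((σ : ℂ) * σ + 2 * M * σ + c)
        - ((σ : ℂ) * σ - A ^ 2) * (1 * (σ : ℂ) + (σ : ℂ) * 1 + 2 * M * 1))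
        / ((σ : ℂ) * σ + 2 * M * σ + c) ^ 2 / 2 := by
    simp only [BalanceParams.halfDeriv, hfun, hK, hE.deriv]
  rw [hval, hDσ]
  have hM0' : (p : ℂ) ^ 2 + q ^ 2 ≠ 0 := by rwa [hM] at hM0
  simp only [hA, hM, hσ]
  push_cast
  field_simp
  ring_nf
  simp only [Complex.I_sq]
  ring

/-- **Non-vacuity / `n = 1` sanity**: a sub-extremal Kerr black hole (`0 < |a| < M`, i.e. `0 < q² < p²`)
is a balance candidate for `n = 1` (no inner axis segment, so no strut condition): it satisfies the
parameter conditions, the consistency identity, NUT-freeness and `8π|J| < A` (`J = Ma`, `A = 8πMr₊`).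
[cite: Hennig2026, §4 (case n = 1); NeugebauerHennig2009 eqs. (51)–(54); HennigAnsorgCederbaum2008] -/
theorem kerr_mem_balanceCandidates (p q : ℝ) (hq : q ≠ 0) (hpq : q ^ 2 < p ^ 2) :
    kerr p q ∈ balanceCandidates 1 (fun _ => True) := by
  have hp : p ≠ 0 := by
    rintro rfl
    nlinarith [sq_nonneg q]
  have hM : 0 < p ^ 2 + q ^ 2 := by nlinarith [sq_nonneg q, sq_pos_of_ne_zero hp]
  have hσ : 0 < p ^ 2 - q ^ 2 := by linarith
  refine ⟨⟨?_, ?_, ?_⟩, kerr_paramConditions p q hp hq, kerr_axisDataConsistent p q hp hq,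
    kerr_nutFree p q, trivial, ?_⟩
  · -- poles strictly decreasing: σ > −σ
    intro i j hij
    fin_cases i <;> fin_cases j <;> simp [kerr] at hij ⊢
    linarith
  · intro i
    fin_cases i
    simp [kerr, hp, hq, hM.ne']
  · intro m
    have key : ∀ x y : ℝ, y ≠ 0 → (x : ℂ) + I * y ≠ 0 := by
      intro x y hy h
      apply hy
      simpa using congrArg Complex.im h
    have hy : (-(2 * p * q) : ℝ) ≠ 0 := by simp [hp, hq]
    fin_cases m
    · convert key (2 * p ^ 2) (-(2 * p * q)) hy using 1
      simp [BalanceParams.rEval, kerr]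
      ring
    · convert key (2 * q ^ 2) (-(2 * p * q)) hy using 1
      simp [BalanceParams.rEval, kerr]
      ring
  · intro i
    obtain rfl : i = 0 := Subsingleton.elim i 0
    have hκ : (kerr p q).surfaceGravity 0 = (p ^ 2 - q ^ 2) / (2 * (p ^ 2 + q ^ 2) * (2 * p ^ 2)) := by
      simp only [BalanceParams.surfaceGravity, kerr_halfDeriv p q hp hq, Complex.add_re,
        Complex.ofReal_re, Complex.mul_re, Complex.I_re, Complex.I_im, Complex.ofReal_im]
      ring
    have hJ : (kerr p q).angularMomentum 0 = 2 * p * q * (p ^ 2 + q ^ 2) := by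
      simp [BalanceParams.angularMomentum, BalanceParams.komarMass, kerr, BalanceParams.top,
        BalanceParams.bot]
      field_simp
      ring
    have hA : (kerr p q).horizonArea 0 = 16 * Real.pi * p ^ 2 * (p ^ 2 + q ^ 2) := by
      simp only [BalanceParams.horizonArea, hκ]
      simp [kerr, BalanceParams.top, BalanceParams.bot]
      field_simp
      ring
    rw [hJ, hA]
    have habs : |q| < |p| := sq_lt_sq.mp hpq
    have hp0 : 0 < |p| := abs_pos.mpr hp
    have h1 : 0 < Real.pi * (p ^ 2 + q ^ 2) * |p| := by positivity
    rw [show |2 * p * q * (p ^ 2 + q ^ 2)| = 2 * |p| * |q| * (p ^ 2 + q ^ 2) by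
      rw [abs_mul, abs_mul, abs_mul, abs_of_pos hM, abs_two]]
    nlinarith [mul_pos h1 (sub_pos.mpr habs), sq_abs p]

end Literature.Geometry.Lorentzian.Ernst
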